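import Summits.ResolutionOfSingularities.ResolutionOfSingularities.Theorems.FrobeniusLadderFInjectiveMacaulayficationFiniteModificationOfBlowup
import HarnessLib

/-!
# ROUTE T-F «FULL SLICE» under #4β: CMFI deforms ⇒ (sliceable centres ⇒ #4β) — `ClosedCentreExists`, `CMFIDeforms`,
# `SliceableCentreExists` and the sorry-free kernel `closedCentreExists_of_sliceable` (crux `FInjectiveMacaulayfication`
# stmt-ResolutionOfSingularities-15315, chain w45a; res-L1-w45a-plan-1 R13.47 (1)(β) / R13.48 (2); text = res-L1-w45a-strat-1
# `H4LocRepairSig.lean` §10‴ (v1.7 7b47fdfa487bb248 … v1.10 a1babb9a53588df4, bodies unchanged) VERBATIM, with the clause abbreviations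
# `CMCl`/`FCl`/`CentreData` of §1′; tri-2 junk/«≤ S» PASS 16:21:45Z; filer res-L1-w45a-stub-4)

[OURS · L1 W4.5a] Support file (`--supports stmt-ResolutionOfSingularities-15315 --as helper`); NOT a statement of any manuscript;
AI-written (AI review is weaker than expert review). Replaces the role of NOTHING in H. Hironaka's manuscript. Definitions are
`Prop`-valued statements (`abbrev`/`@[conjecture] def`; no instances, no notation); `CMFIDeforms` is a PUBLISHED fact typed as a
hypothesis BY NAME (Fedder 1983 / Quy–Shimomoto 2017; FACT WANTED on the L-lane, R13.47 (1)(α)); `SliceableCentreExists` (NC′-∃) is the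
OPEN research content of the line; `ClosedCentreExists` is #4β (door v30's `stub_closedCentreExists`) in clause abbreviations.

THE POINT (strat-1, ROUTES-DIM4 / Sig §10‴). The one classical engine that manufactures F-injectivity WITHOUT resolving: CMFI deforms
(`R` Noetherian local, `t` a nonzerodivisor in `𝔪`, `R/t` Cohen–Macaulay and F-injective ⇒ `R` Cohen–Macaulay and F-injective; with
Quy–Shimomoto §3, F-injective ⟺ parameter ideals Frobenius closed on CM rings, so the clause forms are the same statement). Consequence
(COR NC, `closedCentreExists_of_sliceable`): if EVERY point of `Bl_J X₁` over `V(J)` carries such a slice — in particular if the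
exceptional divisor `E_J = Proj(gr_J 𝒪)` is itself CM and F-injective — then `Bl_J X₁` is FULL over `V(J)`, which is #4β's conclusion
for `J`. So #4β ⇐ `SliceableCentreExists`. NOT a characterisation (ordinary elliptic cone; weighted blow-ups; complete-intersection
centres are useless, `OneSop.parameterCentre_noGo_of_not_fInjective`). [folklore assembly]
-/

-- single-problem summit: the doubled namespace component is forced
set_option linter.dupNamespace false

noncomputable section

open AlgebraicGeometry CategoryTheory Literature.AlgebraicGeometry.Resolution TopologicalSpace IsLocalRing

namespace Summit.ResolutionOfSingularities.ResolutionOfSingularities.Theorems.FInjectiveMacaulayfication.SliceableCentre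

open Summit.ResolutionOfSingularities.ResolutionOfSingularities.Theorems.FInjectiveMacaulayfication

/-! ## §1 Clause abbreviations (res-L1-w45a-strat-1 Sig §1′, verbatim) -/

/-- The CM clause of the crux at a ring `A`: every system of parameters (typed: `d = dim A` elements generating an ideal with maximal
radical) is weakly regular. [folklore; OURS abbreviation] -/
abbrev CMCl (A : Type) [CommRing A] : Prop :=
  ∀ d : ℕ, ringKrullDim A = d → ∀ s : Fin d → A, (Ideal.span (Set.range s)).radical.IsMaximal →
    RingTheory.Sequence.IsWeaklyRegular A (List.ofFn s)

/-- The Frobenius-closure clause of the crux at `A` (parameter ideals Frobenius-closed). [folklore; OURS abbreviation] -/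
abbrev FCl (p : ℕ) (A : Type) [CommRing A] : Prop :=
  ∀ d : ℕ, ringKrullDim A = d → ∀ s : Fin d → A, (Ideal.span (Set.range s)).radical.IsMaximal →
    ∀ y : A, (∃ e : ℕ, y ^ p ^ e ∈ Ideal.span ((fun z : A => z ^ p ^ e) '' (Ideal.span (Set.range s) : Set A))) →
      y ∈ Ideal.span (Set.range s)

/-- FULL at `A`: domain ∧ (CM clause ∧ F-clause, merged under one parameter binder) — the crux's stalk clause verbatim. [folklore; OURS abbreviation] -/
abbrev FullCl (p : ℕ) (A : Type) [CommRing A] : Prop :=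
  IsDomain A ∧ ∀ d : ℕ, ringKrullDim A = d → ∀ s : Fin d → A, (Ideal.span (Set.range s)).radical.IsMaximal →
    RingTheory.Sequence.IsWeaklyRegular A (List.ofFn s) ∧
    ∀ y : A, (∃ e : ℕ, y ^ p ^ e ∈ Ideal.span ((fun z : A => z ^ p ^ e) '' (Ideal.span (Set.range s) : Set A))) →
      y ∈ Ideal.span (Set.range s)

/-- #4β(b): a GLOBAL nonzero centre `J` with `b ∈ supp J` such that EVERY blow-up along `J` is FULL at EVERY point over `supp J`
(= the conclusion of the door's hypothesis `h4β` of `OfFactsClosedCentre.fInjectiveMacaulayfication_of_closedCentre_schemeOpen`, verbatim). [folklore; OURS abbreviation] -/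
abbrev CentreData (p : ℕ) (X₁ : Scheme.{0}) (b : X₁) : Prop :=
  ∃ J : X₁.IdealSheafData, J ≠ ⊥ ∧ b ∈ (J.support : Set X₁) ∧
    ∀ (X' : Scheme.{0}) (π : X' ⟶ X₁), IsBlowup π J →
      ∀ x' : X', π.base x' ∈ (J.support : Set X₁) → FullCl p (X'.presheaf.stalk x')

/-! ## §2 #4β, CMFI deforms, sliceable centres (Sig §10‴, verbatim) -/

/-- #4β in clause abbreviations — reducibly the text of door v30's `stub_closedCentreExists` (and of
`closedCentreExists_of_tame_of_wfix`). [candidate statement, OURS; = door v30's `stub_closedCentreExists` text] -/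
@[conjecture] def ClosedCentreExists : Prop :=
  ∀ (p : ℕ), p.Prime → ∀ (k : Type) [Field k] [CharP k p] (X₁ : Scheme.{0}) (f₁ : X₁ ⟶ Spec (.of k)),
    IsSeparated f₁ → LocallyOfFiniteType f₁ → QuasiCompact f₁ → IsIntegral X₁ →
    (∀ x : X₁, CMCl (X₁.presheaf.stalk x)) → Set.Finite {x : X₁ | ¬ FCl p (X₁.presheaf.stalk x)} →
    ∀ b : X₁, IsClosed ({b} : Set X₁) → ¬ FCl p (X₁.presheaf.stalk b) → CentreData p X₁ b

/-- NAMED-FACT candidate **CMFI DEFORMS** (clause form): for a Noetherian local ring `R` of prime characteristic `p` and a nonzerodivisor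
`t ∈ 𝔪_R`, if `R/t` satisfies the CM clause and the F-clause then so does `R`. (Fedder 1983, Thm. 3.4; Quy–Shimomoto 2017, §3;
Matsumura 1987, Thm. 17.3 — a PUBLISHED fact in clause form; typed here as a hypothesis BY NAME until the Literature named fact is LIVE,
res-L1-w45a-plan-1 R13.47 (1)(α); OURS typing.) -/
@[conjecture] def CMFIDeforms : Prop :=
  ∀ (p : ℕ), p.Prime → ∀ (R : Type) [CommRing R] [IsNoetherianRing R] [IsLocalRing R] [CharP R p] (t : R),
    t ∈ maximalIdeal R → t ∈ nonZeroDivisors R →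
    CMCl (R ⧸ Ideal.span {t}) → FCl p (R ⧸ Ideal.span {t}) → CMCl R ∧ FCl p R

/-- (NC′-∃) **SLICEABLE CENTRE EXISTS**: #4β's hypotheses ⇒ a centre `J ∋ b` such that every point of every blowing up along `J`
lying over `Supp J` has a domain stalk carrying a nonzerodivisor `t ∈ 𝔪` with `𝒪/t` CM-clause and F-clause (e.g. the local equation of
a CM, F-injective exceptional divisor). OPEN in every dimension ≥ 4 (dim ≤ 3: regular models, any regular parameter). [candidate statement, OURS · research stub of route T-F] -/
@[conjecture] def SliceableCentreExists : Prop :=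
  ∀ (p : ℕ), p.Prime → ∀ (k : Type) [Field k] [CharP k p] (X₁ : Scheme.{0}) (f₁ : X₁ ⟶ Spec (.of k)),
    IsSeparated f₁ → LocallyOfFiniteType f₁ → QuasiCompact f₁ → IsIntegral X₁ →
    (∀ x : X₁, CMCl (X₁.presheaf.stalk x)) → Set.Finite {x : X₁ | ¬ FCl p (X₁.presheaf.stalk x)} →
    ∀ b : X₁, IsClosed ({b} : Set X₁) → ¬ FCl p (X₁.presheaf.stalk b) →
      ∃ J : X₁.IdealSheafData, J ≠ ⊥ ∧ b ∈ (J.support : Set X₁) ∧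
        ∀ (X' : Scheme.{0}) (π : X' ⟶ X₁), IsBlowup π J →
          ∀ x' : X', π.base x' ∈ (J.support : Set X₁) →
            IsDomain (X'.presheaf.stalk x') ∧
            ∃ t : X'.presheaf.stalk x', t ∈ maximalIdeal (X'.presheaf.stalk x') ∧
              t ∈ nonZeroDivisors (X'.presheaf.stalk x') ∧
              CMCl (X'.presheaf.stalk x' ⧸ Ideal.span {t}) ∧ FCl p (X'.presheaf.stalk x' ⧸ Ideal.span {t})

/-- **COR NC (kernel of route T-F, sorry-free): CMFI deforms ⇒ (sliceable centres ⇒ #4β).** Plumbing: the blown-up scheme is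
Noetherian (`FiniteModificationOfBlowup.isNoetherian_of_isBlowup'` over `Scheme.isNoetherian_of_finiteType_over_field`), so its
stalks are Noetherian local rings, of characteristic `p` through `k → Γ(X₁) → Γ(X') → 𝒪_{X',x'}`. [OURS assembly] -/
theorem closedCentreExists_of_sliceable (hFed : CMFIDeforms) (h : SliceableCentreExists) : ClosedCentreExists := by
  intro p hp k _ _ X₁ f₁ hs hl hq hi hc hf b hbcl hb
  obtain ⟨J, hJ, hbJ, hall⟩ := h p hp k X₁ f₁ hs hl hq hi hc hf b hbcl hb
  refine ⟨J, hJ, hbJ, fun X' π hπ x' hx' => ?_⟩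
  obtain ⟨hdom, t, htm, htreg, hCM, hFI⟩ := hall X' π hπ x' hx'
  haveI := hdom
  haveI := hl
  haveI := hq
  haveI : IsNoetherian X₁ := Scheme.isNoetherian_of_finiteType_over_field f₁
  haveI : IsNoetherian X' := FiniteModificationOfBlowup.isNoetherian_of_isBlowup' hπ
  haveI : CharP (X'.presheaf.stalk x') p :=
    CharP.of_ringHom_of_ne_zero
      ((X'.presheaf.germ ⊤ x' trivial).hom.comp ((π ≫ f₁).appTop.hom.comp (Scheme.ΓSpecIso (.of k)).inv.hom)) p hp.ne_zero
  obtain ⟨hCM', hFI'⟩ := hFed p hp (X'.presheaf.stalk x') t htm htreg hCM hFI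
  exact ⟨hdom, fun d hd s hrad => ⟨hCM' d hd s hrad, hFI' d hd s hrad⟩⟩

end Summit.ResolutionOfSingularities.ResolutionOfSingularities.Theorems.FInjectiveMacaulayfication.SliceableCentre

end
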